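import Summits.ResolutionOfSingularities.ResolutionOfSingularities.Theorems.HilbertSamuelEliminationSigmaMaxModificationsCorridor3WLadderE1GeneralStep
import Summits.ResolutionOfSingularities.ResolutionOfSingularities.Theorems.HilbertSamuelEliminationSigmaMaxModificationsCorridor3WLadderIsoTailsFreeRationalArcLimitLow
import Summits.ResolutionOfSingularities.ResolutionOfSingularities.Theorems.HilbertSamuelEliminationSigmaMaxModificationsCorridor3RegularPresentation
import HarnessLib

/-!
# [OURS · L1 W4.2] The `e = 1` door OUTSIDE the hypersurface cell, step 5 — **AN `e = 1` NEAR-POINT TOWER OUT OF A STAGE ISOLATED AT LEVEL 1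
# IS IMPOSSIBLE, IN EVERY EMBEDDING DIMENSION** (no hypersurface datum, no Cor. 6.37, no standard bases)
# (crux `SigmaMaxModifications` stmt-ResolutionOfSingularities-18506 / conjunct stmt-…-19249, line `w_ladder_rows` v8.5, row `stub_twoClaims` (β);
# `--supports 19249`, helper)

Stub worker res-L1-w42-stub-3 (gen 6). Sorry-free PROOF file, no definition, no named fact. OURS bookkeeping for the W4.2 crux chain
(cell res-hironaka); NOT a statement of [Hironaka2017] nor of [CossartJannsenSaito2020]. AI-written; AI review is weaker than expert review.

`E1Free.false_of_e1PointTower_of_isolatedStageOne` — the general-embedding-dimension twin of `false_of_e1PointTower_of_hypersurfaceStage` (p544245):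
a point tower `(T, x_n)` at level `3` over a maximal origin of characteristic `p` with `e(x_n) = 1` and `x_{n+1} ∈ ℙ(Dir x_n)` for all `n`, whose stage `1`
is ISOLATED in `(X_1)_max`, is impossible. Proof: a MINIMAL regular presentation `σ : R ↠ 𝒪_{X_0,x_0}` (`emb.dim R = emb.dim 𝒪`, stub-2's
`exists_regular_presentation_stalk_with_coefficientField` cut down by `TameWild.exists_regular_quotient_presentation'`, Matsumura 14.2) with a
transversal slot (`exists_linForm_notMem_directrixSpace`) propagates along the tower by `exists_presentation_step_ideal_of_eq` (the Hilbert-function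
mechanism of `…E1GeneralTransversal`); two consecutive steps make every step NON-SATELLITE, `projDir_line` makes every step RATIONAL, and the
grade-free K1 end in every embedding dimension (`IsoTailsHS.false_of_pointTower_of_forall_freeRational`, stub-2's arc limit) concludes.

[OURS · L1 W4.2; AI-written] [cite: CossartJannsenSaito2020, Def. 6.34, Cor. 6.37, Lemma 2.7] [cite: CossartPiltant2009, ch. 3 I.9] [cite: Matsumura1987, Thm. 14.2]
-/

set_option linter.dupNamespace false

noncomputable section

open CategoryTheory AlgebraicGeometry TopologicalSpace IsLocalRing MvPolynomial Module
open Literature.RingTheory.MvPolynomial Literature.RingTheory.HilbertSamuel Literature.AlgebraicGeometry.Resolution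
open Literature.AlgebraicGeometry.CossartJannsenSaito2020
open Scheme.IdealSheafData
open Summit.ResolutionOfSingularities.ResolutionOfSingularities.Theorems.CampaignW42
open Summit.ResolutionOfSingularities.ResolutionOfSingularities.Theorems.SigmaMaxModificationsCorridor3.Helpers
open Summit.ResolutionOfSingularities.ResolutionOfSingularities.Cruxes.SigmaMaxModifications.IdeasL1C5
open Summit.ResolutionOfSingularities.ResolutionOfSingularities.Cruxes.SigmaMaxModifications.IdeasL1C4

namespace Summit.ResolutionOfSingularities.ResolutionOfSingularities.Theorems.SigmaMaxModificationsCorridor3.E1Free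

universe u

/-- **A MINIMAL regular presentation of the local ring of a maximal origin**: `σ : R ↠ 𝒪_{X,x}` with `R` regular local and
`emb.dim R = emb.dim 𝒪_{X,x}` (a localised polynomial ring over the ground field, cut down by Matsumura 14.2). [cite: Matsumura1987, Thm. 14.2] -/
theorem exists_minimal_regular_presentation_of_isMaximalOrigin {p N : ℕ} {ν : ℕ → ℕ} {X : Scheme.{u}} [IsLocallyNoetherian X] {x : X}
    (hX : IsMaximalOrigin p N ν X x) :
    ∃ (R : Type u) (_ : CommRing R) (_ : IsRegularLocalRing R) (σ : R →+* X.presheaf.stalk x),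
      Function.Surjective σ ∧ (maximalIdeal R).spanFinrank = (maximalIdeal (X.presheaf.stalk x)).spanFinrank := by
  obtain ⟨k, _, _, g, -, hft, -⟩ := hX.exists_structure
  haveI := hft
  obtain ⟨R₀, _, _, -, -, σ₀, hσ₀⟩ := IsoTailsHS.exists_regular_presentation_stalk_with_coefficientField g x
  obtain ⟨J, hJ, hJreg, hJdim⟩ := TameWild.exists_regular_quotient_presentation' σ₀ hσ₀
  haveI : IsRegularLocalRing (R₀ ⧸ J) := hJreg
  refine ⟨R₀ ⧸ J, inferInstance, hJreg, Ideal.Quotient.lift J σ₀ fun a ha => hJ ha, fun b => ?_, ?_⟩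
  · obtain ⟨a, rfl⟩ := hσ₀ b
    exact ⟨Ideal.Quotient.mk J a, rfl⟩
  · have h := IsRegularLocalRing.spanFinrank_maximalIdeal (R := R₀ ⧸ J)
    rw [hJdim] at h
    exact_mod_cast h

/-- **AN `e = 1` NEAR-POINT TOWER OUT OF A STAGE ISOLATED AT LEVEL `1`, OVER A MAXIMAL ORIGIN, IS IMPOSSIBLE — EVERY EMBEDDING DIMENSION**
(module docstring). [OURS · L1 W4.2; AI-written] [cite: CossartJannsenSaito2020, Def. 6.34, Cor. 6.37, Lemma 2.7] [cite: CossartPiltant2009, ch. 3 I.9] -/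
theorem false_of_e1PointTower_of_isolatedStageOne {p : ℕ} {ν : ℕ → ℕ} {T : BlowupTower.{u}} {pt : ∀ n, T.X n}
    (hC : ∀ n, T.C n = {pt n}) (hπ : ∀ n, (T.π n).base (pt (n + 1)) = pt n)
    (hcl : ∀ n, IsClosed ({pt n} : Set (T.X n))) (hν : ∀ n, Scheme.hsFun (T.X n) 3 (pt n) = ν)
    (h0 : IsMaximalOrigin p 3 ν (T.X 0) (pt 0))
    (hiso1 : @IsIsolatedInHSMaxLocus (T.X 1) (T.ln 1) 3 (pt 1))
    (he1 : ∀ n, @Scheme.dirDim (T.X n) (T.ln n) (pt n) = 1)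
    (hon : ∀ n, @IsOnProjDirectrix (T.X (n + 1)) (T.X n) (T.ln n) (T.π n) (pt (n + 1))) : False := by
  classical
  haveI : ∀ n, IsLocallyNoetherian (T.X n) := T.ln
  -- blow-ups of the reduced marked points, excellence, `H^{(0)}` constant
  have hblow : ∀ n, IsBlowup (T.π n) (vanishingIdeal ⟨{pt n}, hcl n⟩) :=
    IsoTailsHS.isBlowup_singleton_of_pointTower hC hcl
  have hexc : Scheme.IsExcellent (T.X 0) := isExcellent_of_isMaximalOrigin h0
  have hHS : ∀ n, hilbertSamuelFun ((T.X (n + 1)).presheaf.stalk (pt (n + 1))) 0 =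
      hilbertSamuelFun ((T.X n).presheaf.stalk (pt n)) 0 := fun n =>
    (IsoTailsHS.hilbertSamuelFun_stalk_eq_of_tower hexc h0.dim_le hπ hcl hν (n + 1) 0).trans
      (IsoTailsHS.hilbertSamuelFun_stalk_eq_of_tower hexc h0.dim_le hπ hcl hν n 0).symm
  -- a minimal regular presentation at stage `0` with a transversal slot
  obtain ⟨R, _, _, σ, hσ, hd⟩ := exists_minimal_regular_presentation_of_isMaximalOrigin h0
  set d := (maximalIdeal ((T.X 0).presheaf.stalk (pt 0))).spanFinrank with hddef
  obtain ⟨c₀, hc₀⟩ := exists_regularSystemOfParameters (R := R)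
  let c : Fin d → R := c₀ ∘ Fin.cast hd.symm
  have hc : Ideal.span (Set.range c) = maximalIdeal R := by
    have hsurj : Function.Surjective (Fin.cast hd.symm) := fun i => ⟨Fin.cast hd i, by simp⟩
    rw [show Set.range c = Set.range c₀ by rw [Set.range_comp, hsurj.range_eq, Set.image_univ]]
    exact hc₀
  have hxA : Ideal.span (Set.range (σ ∘ c)) = maximalIdeal ((T.X 0).presheaf.stalk (pt 0)) :=
    span_range_comp_eq_maximalIdeal hc σ hσ
  have hdA : (maximalIdeal ((T.X 0).presheaf.stalk (pt 0))).spanFinrank = d := rfl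
  have he0 : directrixDim (tangentConeIdeal (σ ∘ c) hxA) = 1 := by
    rw [← dirDim_eq' ((T.X 0).presheaf.stalk (pt 0)) hdA (σ ∘ c) hxA]; exact he1 0
  obtain ⟨j₀, hj₀⟩ := exists_linForm_notMem_directrixSpace hxA hdA (by rw [he0]; exact Nat.one_pos) hxA
    (fun l i => if i = l then (1 : (T.X 0).presheaf.stalk (pt 0)) else 0) (fun l => by
      rw [Finset.sum_eq_single l (fun i _ hi => by rw [if_neg hi, zero_mul]) (fun h => absurd (Finset.mem_univ l) h),
        if_pos rfl, one_mul])
  have htrans0 : (X j₀ : MvPolynomial (Fin d) (ResidueField ((T.X 0).presheaf.stalk (pt 0)))) ∉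
      directrixSpace (tangentConeIdeal (σ ∘ c) hxA) := by
    have hfun : (fun i => residue ((T.X 0).presheaf.stalk (pt 0)) (if i = j₀ then (1 : (T.X 0).presheaf.stalk (pt 0)) else 0)) =
        Pi.single j₀ 1 := by
      funext i
      by_cases hi : i = j₀
      · subst hi; rw [if_pos rfl, map_one, Pi.single_eq_same]
      · rw [if_neg hi, map_zero, Pi.single_eq_of_ne hi]
    rw [hfun, linForm_single] at hj₀
    exact hj₀
  -- THE INDUCTION: a transversal minimal presentation at every stage
  have P : ∀ n, ∃ (R' : Type u) (_ : CommRing R') (_ : IsRegularLocalRing R') (y : Fin d → R')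
      (τ : R' →+* (T.X n).presheaf.stalk (pt n)) (hy : Ideal.span (Set.range y) = maximalIdeal R') (hτ : Function.Surjective τ),
      (maximalIdeal R').spanFinrank = d ∧ (maximalIdeal ((T.X n).presheaf.stalk (pt n))).spanFinrank = d ∧
      (X j₀ : MvPolynomial (Fin d) (ResidueField ((T.X n).presheaf.stalk (pt n)))) ∉
        directrixSpace (tangentConeIdeal (τ ∘ y) (span_range_comp_eq_maximalIdeal hy τ hτ)) := by
    intro n
    induction n with
    | zero => exact ⟨R, inferInstance, inferInstance, c, σ, hc, hσ, hd, hdA, htrans0⟩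
    | succ n ih =>
      obtain ⟨R', i1, i2, y, τ, hy, hτ, hd', hdAn, htr⟩ := ih
      obtain ⟨R'', j1, j2, y', τ', hy', hτ', hd'', hdA', -, -, htr'⟩ :=
        exists_presentation_step_ideal_of_eq (T.isBlowup n) (pt (n + 1)) (pt n) (hπ n)
          (EmbeddedStep.stalkIdeal_centreIdeal_eq_maximalIdeal T pt n (hC n) (hcl n)) (hcl n) (hblow n) hd' y hy τ hτ hdAn j₀
          (he1 n) (hon n) (hHS n) (by rw [he1 (n + 1)]) htr
      exact ⟨R'', j1, j2, y', τ', hy', hτ', hd'', hdA', htr'⟩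
  -- every step is NOT a satellite step: two consecutive applications of the step
  have hnsat : ∀ n, ¬ IsSatelliteStep T pt n := by
    intro n
    obtain ⟨R', i1, i2, y, τ, hy, hτ, hd', hdAn, htr⟩ := P n
    obtain ⟨R'', j1, j2, y', τ', hy', hτ', hd'', hdA', hlink, hE, htr'⟩ :=
      exists_presentation_step_ideal_of_eq (T.isBlowup n) (pt (n + 1)) (pt n) (hπ n)
        (EmbeddedStep.stalkIdeal_centreIdeal_eq_maximalIdeal T pt n (hC n) (hcl n)) (hcl n) (hblow n) hd' y hy τ hτ hdAn j₀
        (he1 n) (hon n) (hHS n) (by rw [he1 (n + 1)]) htr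
    obtain ⟨-, -, -, -, -, -, -, -, -, -, hE', -⟩ :=
      exists_presentation_step_ideal_of_eq (T.isBlowup (n + 1)) (pt (n + 2)) (pt (n + 1)) (hπ (n + 1))
        (EmbeddedStep.stalkIdeal_centreIdeal_eq_maximalIdeal T pt (n + 1) (hC (n + 1)) (hcl (n + 1))) (hcl (n + 1)) (hblow (n + 1))
        hd'' y' hy' τ' hτ' hdA' j₀ (he1 (n + 1)) (hon (n + 1)) (hHS (n + 1)) (by rw [he1 (n + 2)]) htr'
    have hc' : Ideal.span (Set.range (τ' ∘ y')) = maximalIdeal ((T.X (n + 1)).presheaf.stalk (pt (n + 1))) :=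
      span_range_comp_eq_maximalIdeal hy' τ' hτ'
    refine (EmbeddedStep.not_isSatelliteStep_iff_forall_dvd_of_eq T pt n (hπ (n + 1)) hE hc').mpr fun k => ?_
    rw [Function.comp_apply, ← hlink]
    have hk : ((T.X (n + 1)).presheaf.stalkCongr (.of_eq (hπ (n + 1)))).inv ((τ' ∘ y') k) ∈
        maximalIdeal ((T.X (n + 1)).presheaf.stalk ((T.π (n + 1)) (pt (n + 2)))) :=
      stalkCongr_inv_mem_maximalIdeal (hπ (n + 1)) (hc'.le (Ideal.subset_span ⟨k, rfl⟩))
    have hk' := Ideal.mem_map_of_mem ((T.π (n + 1)).stalkMap (pt (n + 2))).hom hk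
    rw [hE'] at hk'
    exact Ideal.mem_span_singleton.mp hk'
  -- every step is RATIONAL
  have hrat : ∀ n, IsRationalStep T pt n := by
    intro n
    have hclπ : IsClosed ({(T.π n) (pt (n + 1))} : Set (T.X n)) := by rw [hπ n]; exact hcl n
    have hblowπ : IsBlowup (T.π n) (vanishingIdeal ⟨{(T.π n) (pt (n + 1))}, hclπ⟩) := by
      have heq : (⟨{(T.π n) (pt (n + 1))}, hclπ⟩ : Closeds (T.X n)) = ⟨{pt n}, hcl n⟩ := by
        congr 1; rw [hπ n]
      rw [heq]; exact hblow n
    have heπ : Scheme.dirDim (T.X n) ((T.π n) (pt (n + 1))) = 1 := by rw [hπ n]; exact he1 n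
    exact residueField_map_surjective_of_isOnProjDirectrix (pt (n + 1)) hclπ hblowπ heπ (hon n)
  -- the grade-free K1 end in every embedding dimension
  exact IsoTailsHS.false_of_pointTower_of_forall_freeRational hC hπ hcl hν
    (fun n => le_trans (he1 n).ge (Scheme.dirDim_le_geomDirDim (pt n))) h0 hiso1 hrat hnsat

end Summit.ResolutionOfSingularities.ResolutionOfSingularities.Theorems.SigmaMaxModificationsCorridor3.E1Free

end
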